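import Literature.AlgebraicGeometry.HodgeTheory.EndAlgebraDegreeEightEvenMultiplicity
import Literature.AlgebraicGeometry.HodgeTheory.ShimuraExceptionalTypeIVFourfolds
import Literature.AlgebraicGeometry.ComplexMultiplication.SimpleFourfoldImaginaryCentre
import Literature.AlgebraicGeometry.HodgeTheory.NoTypeIVFactorIffCentreTotallyReal
import Literature.AlgebraicGeometry.HodgeTheory.SimpleAbelianSurfacePowersHodgeClasses
import Literature.AlgebraicGeometry.HodgeTheory.AbelianLowDimensionNoncommutativeFourfolds
import Literature.AlgebraicGeometry.HodgeTheory.TypeIIRankTwoPowersHodgeClasses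
import Literature.AlgebraicGeometry.HodgeTheory.QuaternionMinimalPowersHodgeClasses
import Literature.AlgebraicGeometry.ComplexMultiplication.EndAlgebraCentralDegreeSquare
import Literature.RingTheory.CentralSimple.PositiveInvolutionQuaternionTotallyReal
import Literature.RingTheory.CentralSimple.AlbertTypes
import Literature.AlgebraicGeometry.Milne1999.CMTypeSimpleIsogenyFactors
import HarnessLib

/-!
# Moonen–Zarhin 1999, Thm. 0.1 for simple abelian fourfolds with non-commutative endomorphism ring — DISCHARGE of
# `MoonenZarhin1999_simpleFourfold_noncommutative_divisorGenerated_or_quaternion`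

For a SIMPLE complex abelian fourfold `X` whose endomorphism ring is not commutative, either every power `X^{N+1}` has a
divisor-generated Hodge ring, or `End⁰(X)` is a totally definite quaternion algebra over `ℚ` whose standard anticommuting
generators, cleared of denominators, are endomorphisms `φ, ψ` with `φ² = -d`, `ψ² = -e` (`d, e ≥ 1`), `φψ = -ψφ`
(Moonen–Zarhin, Duke Math. J. 98 (1999), Thm. 0.1, cases (a)–(d) and part (4)). Proof as in the Summits cell: Albert's
arithmetic `d²e ∣ 2g = 8` (`exists_sq_mul_finrank_center_dvd_two_mul_dim`) leaves `[End⁰:ℚ] ∈ {2, 4, 8}` with centre of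
degree `1` or `2` for a non-commutative simple fourfold; `[End⁰:ℚ] = 4` central: a quaternion algebra over `ℚ`, totally
definite (case (c): integral anticommuting generators, Mumford §19) or totally indefinite (type II(1): divisor-generated powers,
`AbelianVariety.isDivisorGenerated_powSucc_of_fourfold_typeII_rat`); `[End⁰:ℚ] = 8` with quadratic centre: the centre is REAL
quadratic (no factor of type IV — Shimura 1963 Thm. 5 case (5), via the odd/even eigen-multiplicity argument of
`ShimuraExceptionalTypeIVFourfolds` / `EndAlgebraDegreeEightEvenMultiplicity`), so `X` is "quaternion minimal" over a real
quadratic field and its powers are divisor-generated (`AbelianVariety.isDivisorGenerated_powSucc_of_isSimple_quaternion_of_dim_eq`).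

* Part 1 — Albert's arithmetic at `g = 4`: `sq_mul_dvd_eight`, `isTotallyDefinite_or_isTotallyIndefinite_rat`,
  `exists_quaternionAlgebra_of_center`, `center_eq_top_of_isSimple_of_isOfCMType`, `hasNoTypeIVFactor_of_isSimple_of_finrank_eq_eight`
  (row «IV, d = 2» is empty), `exists_quaternion_minimal_of_finrank_eq_eight`.
* Part 2 — `exists_anticommuting_pair_of_isTotallyDefinite_rat` (integral anticommuting generators of a definite quaternion
  algebra `End⁰(X)`) and the discharge `Literature.AlgebraicGeometry.HodgeTheory.MoonenZarhin1999_simpleFourfold_noncommutative_divisorGenerated_or_quaternion_holds`.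

Theorems only; no definition, no new named fact; net named-fact debt −1. Nothing here asserts the Hodge conjecture for these
fourfolds beyond what the cited Literature theorems prove (divisor-generated Hodge rings in the stated cases).

## References

* [MoonenZarhin1999LowDim] B. Moonen, Yu. Zarhin, Hodge classes on abelian varieties of low dimension, Duke Math. J. 98 (1999), Thm. 0.1, §1 (1.1), §2 (2.2).
* [MumfordAV1970] D. Mumford, Abelian Varieties, §19 Thm. 3, §21 (pp. 201–202).
* [Shimura1963AnalyticFamilies] G. Shimura, On analytic families of polarized abelian varieties and automorphic functions, Ann. of Math. 78 (1963), Thm. 5.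
* [HulekLaface2019PicardNumbersAV] K. Hulek, R. Laface, On the Picard numbers of abelian varieties, Ann. Sc. Norm. Super. Pisa (2019), Prop. 5.1.
* [Gordon1997] B. Gordon, A survey of the Hodge conjecture for abelian varieties (1997), §1.13.4.
* [vanGeemen1994HodgeAV] B. van Geemen, An introduction to the Hodge conjecture for abelian varieties (1994), 5.2–5.4.

Provenance: Literature home (namespace `Literature.AlgebraicGeometry.HodgeTheory.NoncommutativeFourfold`) of the used declarations of
the Summits-side `HodgeConjecture/Ring2/RowFourClosed (6/15)` and `HodgeConjecture/Ring2/NoncommutativeFourfoldsFactHolds (2/5)`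
(namespaces `Summit.HodgeConjecture.Ring2.{RowFourClosed, NoncommutativeFourfoldsFactHolds}`; imports `Literature/` and Mathlib only
for the declarations used), re-homed verbatim so that the fact is discharged Literature-side under its exact name.
-/

noncomputable section

namespace Literature.AlgebraicGeometry.HodgeTheory.NoncommutativeFourfold

/-! ## Part 1: Albert's arithmetic at `g = 4`; the rows with `[End⁰:ℚ] = 8` and quadratic centre -/

section Part1

open _root_.CategoryTheory _root_.CategoryTheory.Limits
open scoped TensorProduct

open Literature.AlgebraicGeometry.Motives (AbelianVariety HodgeTensorFacts)
open Literature.AlgebraicGeometry.Motives.AbelianVariety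
open Literature.AlgebraicGeometry.HodgeTheory
open Literature.AlgebraicGeometry.ComplexMultiplication
open Literature.AlgebraicGeometry.Milne1999
open NumberField
open Literature.NumberTheory.Automorphic (IsQuaternionAlgebra IsTotallyDefinite IsSplitAtInfinite)
open Literature.RingTheory.CentralSimple
open Literature.AlgebraicGeometry.HodgeTheory.EndAlgebraDegreeEightEvenMultiplicity

variable {A : AbelianVariety ℂ}

/-! ### §1 Albert's arithmetic at `g = 4` and the packaging of the surviving cells -/

/-- `d² e ∣ 8` with `d ≥ 1`: `(d, e) ∈ {(1,1), (1,2), (1,4), (1,8), (2,1), (2,2)}` (the `g = 4` row of Albert's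
table, Mumford §21). [cite: MumfordAV1970, §21 (pp. 201–202)] [cite: MoonenZarhin1999LowDim, §1 (1.1) and §2] -/
theorem sq_mul_dvd_eight {d e : ℕ} (hd : 0 < d) (h : d ^ 2 * e ∣ 8) :
    (d = 1 ∧ (e = 1 ∨ e = 2 ∨ e = 4 ∨ e = 8)) ∨ (d = 2 ∧ (e = 1 ∨ e = 2)) := by
  have he : e ≠ 0 := by
    rintro rfl
    rw [mul_zero] at h
    exact absurd (zero_dvd_iff.1 h) (by norm_num)
  have hle : d ^ 2 * e ≤ 8 := Nat.le_of_dvd (by norm_num) h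
  have hd2 : d ≤ 2 := by
    by_contra hlt
    have h9 : 3 ^ 2 * 1 ≤ d ^ 2 * e := Nat.mul_le_mul (Nat.pow_le_pow_left (by omega) 2) (Nat.pos_of_ne_zero he)
    omega
  have h8d : Nat.divisors 8 = {1, 2, 4, 8} := by decide
  interval_cases d
  · left
    refine ⟨rfl, ?_⟩
    rw [one_pow, one_mul] at h
    have hmem : e ∈ Nat.divisors 8 := Nat.mem_divisors.2 ⟨h, by norm_num⟩
    rw [h8d] at hmem
    simpa using hmem
  · right
    refine ⟨rfl, ?_⟩
    have h' : e ∣ 2 := by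
      have h4 : (4 : ℕ) * e ∣ 4 * 2 := by simpa [pow_two] using h
      exact Nat.dvd_of_mul_dvd_mul_left (by norm_num) h4
    have hmem : e ∈ Nat.divisors 2 := Nat.mem_divisors.2 ⟨h', by norm_num⟩
    rw [show Nat.divisors 2 = {1, 2} from by decide] at hmem
    simpa using hmem

/-- Over `ℚ` a quaternion algebra is totally definite or totally indefinite (one infinite place). [cite: MoonenZarhin1999LowDim, Thm. 0.1] -/
theorem isTotallyDefinite_or_isTotallyIndefinite_rat (D : Type) [Ring D] [Algebra ℚ D] :
    IsTotallyDefinite ℚ D ∨ IsTotallyIndefinite ℚ D := by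
  by_cases h : IsSplitAtInfinite D Rat.infinitePlace
  · exact Or.inr ⟨fun w => by rwa [Subsingleton.elim w Rat.infinitePlace]⟩
  · exact Or.inl fun w => by rwa [Subsingleton.elim w Rat.infinitePlace]

/-- **A central embedded number field onto the centre of a simple finite-dimensional `ℚ`-algebra of four times its
degree is the centre of a QUATERNION ALGEBRA structure** (`[D:K] = 4`, `D` central simple over `K`; Albert's `d = 2`).
Generic in `D` (the instance arguments are explicit existential witnesses). [cite: MumfordAV1970, §21 (pp. 201–202)]
[cite: MoonenZarhin1999LowDim, §1 (1.1)] -/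
theorem exists_quaternionAlgebra_of_center {D : Type} [Ring D] [Algebra ℚ D] [Module.Finite ℚ D]
    (hS : IsSimpleRing D) (K : Type) [Field K] [NumberField K] (i : K →+* D) (hi : ∀ c x, i c * x = x * i c)
    (hrange : ∀ x ∈ Subalgebra.center ℚ D, x ∈ Set.range i) (hK : Module.finrank ℚ K * 4 = Module.finrank ℚ D) :
    ∃ (_ : Algebra K D) (_ : IsScalarTower ℚ K D), IsQuaternionAlgebra K D := by
  letI iA : Algebra K D := i.toAlgebra' hi
  have halg : algebraMap K D = i := RingHom.algebraMap_toAlgebra' i hi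
  haveI iT : IsScalarTower ℚ K D := IsScalarTower.of_algebraMap_eq fun r => by
    have h := RingHom.ext_rat ((algebraMap K D).comp (algebraMap ℚ K)) (algebraMap ℚ D)
    exact (DFunLike.congr_fun h r).symm
  haveI : Algebra.IsCentral K D := ⟨fun x hx => by
    obtain ⟨k, hk⟩ := hrange x (Subalgebra.mem_center_iff.2 fun b => Subalgebra.mem_center_iff.1 hx b)
    exact Algebra.mem_bot.2 ⟨k, by rw [halg, hk]⟩⟩
  have hKpos : 0 < Module.finrank ℚ K := Module.finrank_pos
  have h4 : Module.finrank K D = 4 := by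
    have h := Module.finrank_mul_finrank ℚ K D
    rw [← hK] at h
    exact Nat.eq_of_mul_eq_mul_left hKpos h
  exact ⟨iA, iT, ⟨hS, h4⟩⟩

/-- **A simple CM fourfold has commutative `End⁰`** (a CM field of degree `8`, Shimura §5.1 Props. 3–4: the tree's
`IsOfCMType.isOfCMTypeSimple`), so its centre is everything. [cite: MumfordAV1970, §21 (pp. 201–202)]
[cite: MoonenZarhin1999LowDim, §2 (2.2)] -/
theorem center_eq_top_of_isSimple_of_isOfCMType (hAs : A.IsSimple) (hA0 : 0 < A.dim) (hcm : IsOfCMType A) :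
    Subalgebra.center ℚ A.endAlgebra = ⊤ := by
  obtain ⟨hF, -⟩ := hcm.isOfCMTypeSimple hAs hA0
  exact eq_top_iff.2 fun x _ => Subalgebra.mem_center_iff.2 fun y => hF.mul_comm y x

/-- **ROW «IV, `d = 2`» IS EMPTY (Shimura 1963 Thm. 5 case (5) at `g = 4`).**  A SIMPLE complex abelian fourfold with
`[End⁰(X):ℚ] = 8` and centre of degree `2` has NO factor of type IV: its centre is a REAL quadratic field (type II(2)
or III(2)), never an imaginary quadratic one — «(5) `F` is of type IV, `m = 1`, `d = 2`, `r_ν = s_ν = 1` … these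
cases never occur»; Gordon §1.13.4 lists no quaternion algebra over an imaginary quadratic field.  PROOF: a CM simple
fourfold has commutative `End⁰`; a non-CM one with a factor of type IV would carry a central endomorphism with an ODD
multiplicity on `H^{1,0}` (the Literature lane's `AbelianVariety.exists_center_odd_eigenMultiplicity_of_finrank_eq_eight`:
the Rosati-stable quartic subfield and Deligne's rigidity), while central endomorphisms under a quaternion algebra have
EVEN multiplicities (`even_eigenMultiplicity_of_isSimple_of_finrank_eq_eight_of_finrank_center_eq_two`).
[cite: Shimura1963AnalyticFamilies, Thm. 5 (case (5))] [cite: HulekLaface2019PicardNumbersAV, Prop. 5.1 (5) and proof]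
[cite: Gordon1997, §1.13.4] [cite: MumfordAV1970, §21 (pp. 201–202)] -/
theorem hasNoTypeIVFactor_of_isSimple_of_finrank_eq_eight (hAs : A.IsSimple) (hA4 : A.dim = 4)
    (h8 : Module.finrank ℚ A.endAlgebra = 8) (hZ2 : Module.finrank ℚ ↥(Subalgebra.center ℚ A.endAlgebra) = 2) :
    HasNoTypeIVFactor A := by
  have hA0 : 0 < A.dim := by omega
  by_contra hIV
  by_cases hcm : IsOfCMType A
  · have htop := center_eq_top_of_isSimple_of_isOfCMType hAs hA0 hcm
    have h := hZ2
    rw [htop, (Subalgebra.topEquiv (R := ℚ) (A := A.endAlgebra)).toLinearEquiv.finrank_eq, h8] at h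
    omega
  · obtain ⟨φ, hφZ, μ, hodd⟩ :=
      AbelianVariety.exists_center_odd_eigenMultiplicity_of_finrank_eq_eight hAs hA4 hcm h8 hZ2 hIV
    exact (Nat.not_even_iff_odd.2 hodd)
      (even_eigenMultiplicity_of_isSimple_of_finrank_eq_eight_of_finrank_center_eq_two hAs h8 hZ2 hφZ μ)

/-- **Type II(2)/III(2) packaged**: a simple fourfold with `[End⁰:ℚ] = 8` and centre of degree `2` carries a quaternion
algebra structure over a TOTALLY REAL (real quadratic) number field `K` with `dim = 2[K:ℚ]` — the second excluded
class of the census (`RowFourTypeIVOneOne`: «minimal quaternion»). `K` is the centre (`CenterField`).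
[cite: MoonenZarhin1999LowDim, §2 (2.2) and §1 (1.1)] [cite: MumfordAV1970, §21 (pp. 201–202)] -/
theorem exists_quaternion_minimal_of_finrank_eq_eight (hAs : A.IsSimple) (hA4 : A.dim = 4)
    (h8 : Module.finrank ℚ A.endAlgebra = 8) (hZ2 : Module.finrank ℚ ↥(Subalgebra.center ℚ A.endAlgebra) = 2) :
    ∃ (K : Type) (_ : Field K) (_ : NumberField K) (_ : IsTotallyReal K) (_ : Algebra K A.endAlgebra)
      (_ : IsScalarTower ℚ K A.endAlgebra) (_ : IsQuaternionAlgebra K A.endAlgebra), A.dim = 2 * Module.finrank ℚ K := by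
  have hA0 : 0 < A.dim := by omega
  haveI : Nontrivial A.endAlgebra := nontrivial_endAlgebra_of_dim_pos hA0
  have hKR : IsTotallyReal (CenterField A hAs hA0) :=
    (hasNoTypeIVFactor_iff_isTotallyReal_centerField hAs hA0).1
      (hasNoTypeIVFactor_of_isSimple_of_finrank_eq_eight hAs hA4 h8 hZ2)
  have hK2 : Module.finrank ℚ (CenterField A hAs hA0) = 2 :=
    ((ratModule_transfer (M := CenterField A hAs hA0)
      (show Module ℚ ↥(Subalgebra.center ℚ A.endAlgebra) from inferInstance) _).1).symm.trans hZ2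
  obtain ⟨iA, iT, iQ⟩ := exists_quaternionAlgebra_of_center (isSimpleRing_endAlgebra_of_isSimple hAs hA0)
    (CenterField A hAs hA0) (CenterField.val hAs hA0)
    (fun c x => (Subalgebra.mem_center_iff.1 (show Subalgebra.center ℚ A.endAlgebra from c).2 x).symm)
    (fun x hx => ⟨(show CenterField A hAs hA0 from ⟨x, hx⟩), rfl⟩) (by rw [hK2, h8])
  exact ⟨CenterField A hAs hA0, inferInstance, inferInstance, hKR, iA, iT, iQ, by rw [hK2, hA4]⟩

end Part1

/-! ## Part 2: Integral anticommuting generators; the discharge of Moonen–Zarhin Thm. 0.1 (simple non-commutative fourfolds) -/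

section Part2

open _root_.CategoryTheory _root_.CategoryTheory.Limits
open scoped TensorProduct

open Literature.AlgebraicGeometry.Motives (AbelianVariety)
open Literature.AlgebraicGeometry.Motives.AbelianVariety
open Literature.AlgebraicGeometry.HodgeTheory
open Literature.AlgebraicGeometry.ComplexMultiplication
open Literature.AlgebraicGeometry.Milne1999
open NumberField
open Literature.NumberTheory.Automorphic (IsQuaternionAlgebra IsTotallyDefinite)
open Literature.RingTheory.CentralSimple

variable {A : AbelianVariety ℂ}

/-! ### §1 Integral anticommuting generators of a definite quaternion algebra over `ℚ` -/

/-- **Integral anticommuting generators.** If `End⁰(X)` is a totally definite quaternion algebra over `ℚ` then there are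
`φ, ψ ∈ End(X)` and integers `d, e ≥ 1` with `φ² = -d`, `ψ² = -e`, `φψ = -ψφ`: `End⁰(X) ≃ ℍ[ℚ,a,b]` with `a, b < 0`
(the tree's `exists_algEquiv_quaternionAlgebra_totallyNeg_of_isTotallyDefinite`), the standard generators `i, j` rescaled
to square to negative integers and cleared of denominators in `End⁰ = ℚ ⊗ End` (Mumford §19 Thm. 3) — verbatim the
construction of the Literature lane's `AbelianVariety.isCodimTwoDivisorWeilGenerated_of_isTotallyDefinite_quaternion`.
[cite: MumfordAV1970, §19 Thm. 3 and §21 (type III)] [cite: MoonenZarhin1999LowDim, Thm. 0.1 (2) (c)] -/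
theorem exists_anticommuting_pair_of_isTotallyDefinite_rat (X : AbelianVariety ℂ) [IsQuaternionAlgebra ℚ X.endAlgebra]
    (hdef : IsTotallyDefinite ℚ X.endAlgebra) :
    ∃ (φ ψ : X ⟶ X) (d e : ℕ), 0 < d ∧ 0 < e ∧ φ ≫ φ = -(d • 𝟙 X) ∧ ψ ≫ ψ = -(e • 𝟙 X) ∧ φ ≫ ψ = -(ψ ≫ φ) := by
  classical
  obtain ⟨a, b, -, -, hneg, ⟨e⟩⟩ := exists_algEquiv_quaternionAlgebra_totallyNeg_of_isTotallyDefinite ℚ X.endAlgebra hdef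
  have ha0 : a < 0 := by have h : ((a : ℝ)) < 0 := (hneg (Rat.castHom ℝ)).1; exact_mod_cast h
  have hb0 : b < 0 := by have h : ((b : ℝ)) < 0 := (hneg (Rat.castHom ℝ)).2; exact_mod_cast h
  set q : QuaternionAlgebra.Basis X.endAlgebra a 0 b :=
    (QuaternionAlgebra.Basis.self ℚ).compHom (e.symm : QuaternionAlgebra ℚ a 0 b →ₐ[ℚ] X.endAlgebra) with hq
  have hii : q.i * q.i = a • (1 : X.endAlgebra) := by rw [q.i_mul_i, zero_smul, add_zero]
  have hjj : q.j * q.j = b • (1 : X.endAlgebra) := q.j_mul_j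
  have hij : q.i * q.j = -(q.j * q.i) := by rw [q.i_mul_j, q.j_mul_i, zero_smul, zero_sub, neg_neg]
  -- integral generators: rescale to square to negative INTEGERS, then clear denominators in `End⁰ = ℚ ⊗ End`
  have hint : ∀ (r : ℚ) (z : X.endAlgebra), r < 0 → z * z = r • (1 : X.endAlgebra) →
      ∃ (F : CategoryTheory.End X) (d : ℕ) (cF : ℚ), 0 < d ∧ cF ≠ 0 ∧ AbelianVariety.endAlgebra.of X F = cF • z ∧
        F ≫ F = -(d • 𝟙 X) := by
    intro r z hr hz
    set z' : X.endAlgebra := (r.den : ℚ) • z with hz'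
    set t : ℤ := (r.den : ℤ) * r.num with ht
    have hrden : (r.den : ℚ) * r = r.num := by rw [mul_comm]; exact Rat.mul_den_eq_num r
    have hz'sq : z' * z' = (t : ℚ) • (1 : X.endAlgebra) := by
      rw [hz', smul_mul_smul_comm, hz, smul_smul, ht, Int.cast_mul, Int.cast_natCast, mul_assoc, hrden]
    have hnum : r.num < 0 := by
      by_contra hge
      exact absurd (Rat.num_nonneg.1 (not_lt.1 hge)) (not_le.2 hr)
    have ht0 : t < 0 := mul_neg_of_pos_of_neg (Int.natCast_pos.2 r.den_pos) hnum
    obtain ⟨M, F, hM, hF⟩ := AbelianVariety.endAlgebra.exists_eq_algebraMap_mul_of z'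
    have hM0 : (M : ℚ) ≠ 0 := Nat.cast_ne_zero.2 hM
    have hofF : AbelianVariety.endAlgebra.of X F = (M : ℚ) • z' := by
      rw [hF, Algebra.smul_def, ← mul_assoc, ← map_mul, mul_inv_cancel₀ hM0, map_one, one_mul]
    set d : ℕ := M * M * t.natAbs with hd
    have htabs : (t.natAbs : ℤ) = -t := Int.ofNat_natAbs_of_nonpos ht0.le
    have hdpos : 0 < d := Nat.mul_pos (Nat.mul_pos (Nat.pos_of_ne_zero hM) (Nat.pos_of_ne_zero hM))
      (Int.natAbs_pos.2 ht0.ne)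
    have hF2 : AbelianVariety.endAlgebra.of X F * AbelianVariety.endAlgebra.of X F = -((d : ℚ) • (1 : X.endAlgebra)) := by
      rw [hofF, smul_mul_smul_comm, hz'sq, smul_smul, hd, Nat.cast_mul, Nat.cast_mul]
      have htq : ((t.natAbs : ℕ) : ℚ) = -(t : ℚ) := by rw [← Int.cast_natCast (R := ℚ) t.natAbs, htabs, Int.cast_neg]
      have hcoef : ((M : ℚ) * M * (t : ℚ)) = -((M : ℚ) * M * (t.natAbs : ℚ)) := by rw [htq]; ring
      rw [hcoef, Algebra.smul_def, map_neg, neg_mul, ← Algebra.smul_def]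
    have hFF : F * F = -(d • (1 : End X)) := by
      apply AbelianVariety.endAlgebra.of_injective_of_charZero (A := X)
      rw [map_mul, hF2, map_neg, map_nsmul, map_one, Nat.cast_smul_eq_nsmul]
    refine ⟨F, d, (M : ℚ) * r.den, hdpos, mul_ne_zero hM0 (Nat.cast_ne_zero.2 r.den_pos.ne'), ?_, hFF⟩
    rw [hofF, hz', smul_smul]
  obtain ⟨φ₁, d₁, c₁, hd₁, hc₁, hφ₁, h₁⟩ := hint a q.i ha0 hii
  obtain ⟨φ₂, d₂, c₂, hd₂, hc₂, hφ₂, h₂⟩ := hint b q.j hb0 hjj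
  have h₁₂ : φ₁ ≫ φ₂ = -(φ₂ ≫ φ₁) := by
    have hE : φ₂ * φ₁ = -(φ₁ * φ₂) := by
      apply AbelianVariety.endAlgebra.of_injective_of_charZero (A := X)
      rw [map_neg, map_mul, map_mul, hφ₁, hφ₂, smul_mul_smul_comm, smul_mul_smul_comm, hij, mul_comm c₂ c₁, smul_neg,
        neg_neg]
    exact hE
  exact ⟨φ₁, φ₂, d₁, d₂, hd₁, hd₂, h₁, h₂, h₁₂⟩

/-! ### §2 The named fact holds -/

/-- **MOONEN–ZARHIN 1999 Thm. 0.1 FOR SIMPLE FOURFOLDS WITH NON-COMMUTATIVE ENDOMORPHISM RING IS A THEOREM OF THE TREE: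
the named fact `MoonenZarhin1999_simpleFourfold_noncommutative_divisorGenerated_or_quaternion` HOLDS.**  Let `A` be a
simple complex abelian fourfold with `ψ ≫ χ ≠ χ ≫ ψ` for some `ψ, χ ∈ End A`.  Then `End⁰(A)` is non-commutative, so
(`d²e ∣ 8`, `d ≥ 2`) `[End⁰(A):ℚ] ∈ {4, 8}` with centre of degree `1`, resp. `2`: a quaternion algebra over `ℚ` —
indefinite, and then `B•(Aⁿ) = D•(Aⁿ)` for all `n` (Moonen–Zarhin 1995 type II / Chi), or definite, and then §1 gives the
anticommuting integral generators — or a quaternion algebra over a REAL quadratic field with `dim A = 2[K:ℚ]`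
(`RowFourClosed.exists_quaternion_minimal_of_finrank_eq_eight`: the imaginary quadratic centre is Shimura's empty case
(5)), and then `B•(Aⁿ) = D•(Aⁿ)` for all `n` (Banaszak–Gajda–Krasoń / Murty, the tree's
`AbelianVariety.isDivisorGenerated_powSucc_of_isSimple_quaternion_of_dim_eq`, which itself excludes type III(2)).
[cite: MoonenZarhin1999LowDim, Thm. 0.1 (cases (a)–(d) and part (4)), §2 (2.2)] [cite: Shimura1963AnalyticFamilies, Thm. 5]
[cite: MumfordAV1970, §19 Cor. 2 and §21] -/
theorem _root_.Literature.AlgebraicGeometry.HodgeTheory.MoonenZarhin1999_simpleFourfold_noncommutative_divisorGenerated_or_quaternion_holds :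
    MoonenZarhin1999_simpleFourfold_noncommutative_divisorGenerated_or_quaternion := by
  intro A hA4 hAs hnc
  have hA0 : 0 < A.dim := by omega
  haveI : Nontrivial A.endAlgebra := nontrivial_endAlgebra_of_dim_pos hA0
  -- `End⁰(A)` is non-commutative
  have hnc' : ∃ x y : A.endAlgebra, x * y ≠ y * x := by
    obtain ⟨ψ, χ, hne⟩ := hnc
    refine ⟨AbelianVariety.endAlgebra.of A χ, AbelianVariety.endAlgebra.of A ψ, fun h => hne ?_⟩
    rw [← map_mul, ← map_mul] at h
    exact AbelianVariety.endAlgebra.of_injective_of_charZero (A := A) h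
  obtain ⟨d, hd, hde, hdvd⟩ := exists_sq_mul_finrank_center_dvd_two_mul_dim hAs hA0
  rw [hA4] at hdvd
  rcases sq_mul_dvd_eight hd hdvd with ⟨rfl, -⟩ | ⟨rfl, he⟩
  · -- `d = 1`: commutative, contradiction
    exfalso
    rw [one_pow, one_mul] at hde
    have htop := center_eq_top_of_finrank_eq hde
    obtain ⟨x, y, hxy⟩ := hnc'
    exact hxy ((Subalgebra.mem_center_iff.1 (show y ∈ Subalgebra.center ℚ A.endAlgebra from htop ▸ Algebra.mem_top) x))
  · rcases he with h | h <;> rw [h] at hde <;> norm_num at hde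
    · -- quaternion algebra over `ℚ`
      haveI hQ : IsQuaternionAlgebra ℚ A.endAlgebra :=
        AbelianVariety.isQuaternionAlgebra_endAlgebra_of_isSimple hAs hA0 hde hnc'
      rcases isTotallyDefinite_or_isTotallyIndefinite_rat A.endAlgebra with hdef | hind
      · exact Or.inr (exists_anticommuting_pair_of_isTotallyDefinite_rat A hdef)
      · exact Or.inl fun N => AbelianVariety.isDivisorGenerated_powSucc_of_fourfold_typeII_rat hAs hind hA4 N
    · -- quaternion algebra over a real quadratic field, `dim = 2[K:ℚ]`
      obtain ⟨K, _, _, _, _, _, _, hdim⟩ := exists_quaternion_minimal_of_finrank_eq_eight hAs hA4 hde h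
      exact Or.inl fun N => AbelianVariety.isDivisorGenerated_powSucc_of_isSimple_quaternion_of_dim_eq hAs hdim N

end Part2

end Literature.AlgebraicGeometry.HodgeTheory.NoncommutativeFourfold

end
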